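import Summits.QuantumFields.YangMills.Theorems.ColdStartUniversalityLatticeLangevinBakryEmeryPoincareFlow
import Mathlib.Analysis.SpecialFunctions.Log.Deriv
import HarnessLib

/-!
# Route `ColdStartUniversality` (fixed-cut-off package, Bakry–Émery side): the HERBST ARGUMENT — an entropy bound for the
# exponential moments gives sub-Gaussian Laplace transform and Gaussian concentration (abstract probability)

Helper file (seat `ym-line-csu-p1`, g26; `--supports stmt-QuantumFields-24809`).  Route-independent measure theory on a probability
space `(X, μ)` for a bounded measurable observable `F`.  HYPOTHESIS (what a log-Sobolev inequality applied to `e^{λF/2}` delivers):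
for every `λ > 0`, `Ent_μ(e^{λF}) = ∫ λF e^{λF} dμ − (∫ e^{λF} dμ) log ∫ e^{λF} dμ ≤ κ λ² ∫ e^{λF} dμ`.  CONCLUSIONS:
* ★★ `integral_exp_mul_le_of_entropy_le` (HERBST): `∫ e^{λF} dμ ≤ exp(λ ∫F dμ + κ λ²)` for every `λ ≥ 0`
  (`Φ(λ) = λ⁻¹ log ∫e^{λF} − κλ` is non-increasing on `(0,∞)` and tends to `∫F dμ` at `0⁺`);
* ★★ `measureReal_ge_le_exp_of_entropy_le` (GAUSSIAN CONCENTRATION): `μ{F ≥ ∫F dμ + r} ≤ exp(−r²/(4κ))` for `r ≥ 0`, `κ > 0`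
  (Chernoff with `λ = r/(2κ)`).
(Herbst's argument as in Ledoux, *The concentration of measure phenomenon* (2001) §5.1 / Boucheron–Lugosi–Massart Thm 5.3; Bakry–Gentil–Ledoux
2014 Prop. 5.4.1.)  THEOREMS ONLY, no definition, no sorry; [folklore].  Nothing here is specific to Yang–Mills; the YM mass gap is NOT proved.
-/

set_option autoImplicit false

noncomputable section

namespace Summit.QuantumFields.YangMills.Theorems.ColdStartUniversality

open MeasureTheory ProbabilityTheory Filter Set
open scoped Topology

/-- Exponential moments of a bounded measurable observable are finite: `e^{λF}` is integrable, `|e^{λF}| ≤ e^{|λ|M}`. [folklore] -/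
theorem integrable_exp_mul_of_abs_le {X : Type*} [MeasurableSpace X] (μ : Measure X) [IsProbabilityMeasure μ]
    {F : X → ℝ} (hFm : Measurable F) {M : ℝ} (hFb : ∀ x, |F x| ≤ M) (l : ℝ) :
    Integrable (fun x => Real.exp (l * F x)) μ := by
  refine Integrable.of_bound ((hFm.const_mul l).exp.aestronglyMeasurable) (Real.exp (|l| * M))
    (ae_of_all _ fun x => ?_)
  rw [Real.norm_eq_abs, abs_of_pos (Real.exp_pos _), Real.exp_le_exp]
  calc l * F x ≤ |l * F x| := le_abs_self _
    _ = |l| * |F x| := abs_mul _ _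
    _ ≤ |l| * M := mul_le_mul_of_nonneg_left (hFb x) (abs_nonneg l)

/-- ★★ **Herbst's argument.**  On a probability space, if a bounded measurable `F` satisfies the entropy bound
`∫ λF e^{λF} dμ − (∫ e^{λF} dμ)·log(∫ e^{λF} dμ) ≤ κ λ² ∫ e^{λF} dμ` for every `λ > 0`, then
`∫ e^{λF} dμ ≤ exp(λ·∫F dμ + κλ²)` for every `λ ≥ 0`. [folklore] -/
theorem integral_exp_mul_le_of_entropy_le {X : Type*} [MeasurableSpace X] (μ : Measure X) [IsProbabilityMeasure μ]
    {F : X → ℝ} (hFm : Measurable F) {M : ℝ} (hFb : ∀ x, |F x| ≤ M) {κ : ℝ}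
    (hEnt : ∀ l : ℝ, 0 < l →
      (∫ x, (l * F x) * Real.exp (l * F x) ∂μ) - (∫ x, Real.exp (l * F x) ∂μ) * Real.log (∫ x, Real.exp (l * F x) ∂μ) ≤
        κ * l ^ 2 * ∫ x, Real.exp (l * F x) ∂μ)
    {l : ℝ} (hl : 0 ≤ l) :
    ∫ x, Real.exp (l * F x) ∂μ ≤ Real.exp (l * (∫ x, F x ∂μ) + κ * l ^ 2) := by
  obtain ⟨H, hH⟩ : ∃ H : ℝ → ℝ, H = fun t => ∫ x, Real.exp (t * F x) ∂μ := ⟨_, rfl⟩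
  have hint : ∀ t, Integrable (fun x => Real.exp (t * F x)) μ := fun t => integrable_exp_mul_of_abs_le μ hFm hFb t
  have hintF : ∀ t, Integrable (fun x => F x * Real.exp (t * F x)) μ := by
    intro t
    refine Integrable.of_bound ((hFm.mul (hFm.const_mul t).exp).aestronglyMeasurable) (M * Real.exp (|t| * M))
      (ae_of_all _ fun x => ?_)
    rw [Real.norm_eq_abs, abs_mul, abs_of_pos (Real.exp_pos _)]
    refine mul_le_mul (hFb x) ?_ (Real.exp_pos _).le ((abs_nonneg _).trans (hFb x))
    rw [Real.exp_le_exp]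
    calc t * F x ≤ |t * F x| := le_abs_self _
      _ = |t| * |F x| := abs_mul _ _
      _ ≤ |t| * M := mul_le_mul_of_nonneg_left (hFb x) (abs_nonneg t)
  have hHpos : ∀ t, 0 < H t := fun t => by rw [hH]; exact integral_exp_pos (hint t)
  have hH0 : H 0 = 1 := by simp [hH]
  -- derivative of `H`
  have hHd : ∀ t₀ : ℝ, HasDerivAt H (∫ x, F x * Real.exp (t₀ * F x) ∂μ) t₀ := by
    intro t₀
    rw [hH]
    have hs : Ioo (t₀ - 1) (t₀ + 1) ∈ 𝓝 t₀ := Ioo_mem_nhds (by linarith) (by linarith)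
    refine (hasDerivAt_integral_of_dominated_loc_of_deriv_le (μ := μ) (x₀ := t₀)
      (F := fun t x => Real.exp (t * F x)) (F' := fun t x => F x * Real.exp (t * F x))
      (bound := fun _ => M * Real.exp ((|t₀| + 1) * M)) hs ?_ (hint t₀) ?_ ?_ (integrable_const _) ?_).2
    · exact Eventually.of_forall fun t => (hint t).aestronglyMeasurable
    · exact (hFm.mul (hFm.const_mul t₀).exp).aestronglyMeasurable
    · refine ae_of_all _ fun x t ht => ?_
      rw [Real.norm_eq_abs, abs_mul, abs_of_pos (Real.exp_pos _)]
      refine mul_le_mul (hFb x) ?_ (Real.exp_pos _).le ((abs_nonneg _).trans (hFb x))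
      rw [Real.exp_le_exp]
      have ht1 : |t| ≤ |t₀| + 1 := by
        rw [abs_le]; constructor <;> linarith [ht.1, ht.2, neg_abs_le t₀, le_abs_self t₀]
      calc t * F x ≤ |t * F x| := le_abs_self _
        _ = |t| * |F x| := abs_mul _ _
        _ ≤ (|t₀| + 1) * M := mul_le_mul ht1 (hFb x) (abs_nonneg _) (by positivity)
    · refine ae_of_all _ fun x t _ => ?_
      have h := ((hasDerivAt_id t).mul_const (F x)).exp
      simp only [id, one_mul] at h
      have e : Real.exp (t * F x) * F x = F x * Real.exp (t * F x) := mul_comm _ _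
      rw [e] at h
      exact h
  -- slope of `log H` at `0⁺`
  have hG0 : HasDerivAt (fun t => Real.log (H t)) (∫ x, F x ∂μ) 0 := by
    have h := (hHd 0).log (hHpos 0).ne'
    have e : (∫ x, F x * Real.exp (0 * F x) ∂μ) / H 0 = ∫ x, F x ∂μ := by
      rw [hH0, div_one]
      exact integral_congr_ae (ae_of_all _ fun x => by simp)
    rw [e] at h
    exact h
  have hslope : Tendsto (fun t : ℝ => Real.log (H t) / t - κ * t) (𝓝[>] 0) (𝓝 (∫ x, F x ∂μ)) := by
    have h1 := hG0.tendsto_slope_zero_right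
    simp only [zero_add, hH0, Real.log_one, sub_zero, smul_eq_mul] at h1
    have h2 : Tendsto (fun t : ℝ => κ * t) (𝓝[>] 0) (𝓝 0) := by
      have h : Tendsto (fun t : ℝ => κ * t) (𝓝 (0 : ℝ)) (𝓝 (κ * 0)) := tendsto_id.const_mul κ
      rw [mul_zero] at h
      exact h.mono_left nhdsWithin_le_nhds
    have h3 := h1.sub h2
    rw [sub_zero] at h3
    refine h3.congr' (Eventually.of_forall fun t => ?_)
    simp only [div_eq_inv_mul]
  -- `Φ(t) = log H(t)/t − κt` is non-increasing on `(0, ∞)`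
  have hΦd : ∀ t, 0 < t → HasDerivAt (fun t => Real.log (H t) / t - κ * t)
      (((∫ x, F x * Real.exp (t * F x) ∂μ) / H t * t - Real.log (H t) * 1) / t ^ 2 - κ * 1) t :=
    fun t ht => (((hHd t).log (hHpos t).ne').div (hasDerivAt_id t) ht.ne').sub ((hasDerivAt_id t).const_mul κ)
  have hanti : AntitoneOn (fun t => Real.log (H t) / t - κ * t) (Ioi 0) := by
    refine antitoneOn_of_deriv_nonpos (convex_Ioi 0) (fun t ht => (hΦd t ht).continuousAt.continuousWithinAt)
      (fun t ht => ?_) (fun t ht => ?_)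
    · rw [interior_Ioi] at ht
      exact (hΦd t ht).differentiableAt.differentiableWithinAt
    · rw [interior_Ioi] at ht
      have ht' : 0 < t := ht
      rw [(hΦd t ht').deriv]
      have hE := hEnt t ht'
      have e1 : ∫ x, (t * F x) * Real.exp (t * F x) ∂μ = t * ∫ x, F x * Real.exp (t * F x) ∂μ := by
        rw [← integral_const_mul]
        exact integral_congr_ae (ae_of_all _ fun x => by ring)
      rw [e1] at hE
      have hHt : 0 < H t := hHpos t
      have hHt' : (∫ x, Real.exp (t * F x) ∂μ) = H t := by rw [hH]
      rw [hHt'] at hE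
      set A : ℝ := ∫ x, F x * Real.exp (t * F x) ∂μ with hA
      -- `(A/H·t − log H)/t² ≤ κ` from `t·A − H log H ≤ κ t² H`
      have key : (A / H t * t - Real.log (H t) * 1) / t ^ 2 = (t * A - H t * Real.log (H t)) / (t ^ 2 * H t) := by
        field_simp
      rw [key, sub_nonpos, div_le_iff₀ (by positivity)]
      nlinarith [hE]
  -- the case `l = 0`
  rcases hl.eq_or_lt with h0 | hl'
  · rw [← h0]
    simp
  -- `Φ(l) ≤ lim_{t → 0⁺} Φ(t) = ∫ F dμ`
  have hΦle : Real.log (H l) / l - κ * l ≤ ∫ x, F x ∂μ := by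
    refine ge_of_tendsto hslope ?_
    filter_upwards [Ioo_mem_nhdsGT hl'] with t ht
    exact hanti (mem_Ioi.2 ht.1) (mem_Ioi.2 hl') ht.2.le
  have h1 : Real.log (H l) ≤ l * (∫ x, F x ∂μ) + κ * l ^ 2 := by
    have h := hΦle
    rw [sub_le_iff_le_add, div_le_iff₀ hl'] at h
    nlinarith [h]
  have hHl : (∫ x, Real.exp (l * F x) ∂μ) = H l := by rw [hH]
  rw [hHl]
  calc H l = Real.exp (Real.log (H l)) := (Real.exp_log (hHpos l)).symm
    _ ≤ Real.exp (l * (∫ x, F x ∂μ) + κ * l ^ 2) := Real.exp_le_exp.2 h1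

/-- ★★ **Gaussian concentration from the Herbst bound** (Chernoff with `λ = r/(2κ)`): under the entropy bound of
`integral_exp_mul_le_of_entropy_le` with `κ > 0`, `μ{F ≥ ∫F dμ + r} ≤ exp(−r²/(4κ))` for every `r ≥ 0`. [folklore] -/
theorem measureReal_ge_le_exp_of_entropy_le {X : Type*} [MeasurableSpace X] (μ : Measure X) [IsProbabilityMeasure μ]
    {F : X → ℝ} (hFm : Measurable F) {M : ℝ} (hFb : ∀ x, |F x| ≤ M) {κ : ℝ} (hκ : 0 < κ)
    (hEnt : ∀ l : ℝ, 0 < l →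
      (∫ x, (l * F x) * Real.exp (l * F x) ∂μ) - (∫ x, Real.exp (l * F x) ∂μ) * Real.log (∫ x, Real.exp (l * F x) ∂μ) ≤
        κ * l ^ 2 * ∫ x, Real.exp (l * F x) ∂μ)
    {r : ℝ} (hr : 0 ≤ r) :
    μ.real {x | (∫ y, F y ∂μ) + r ≤ F x} ≤ Real.exp (-(r ^ 2 / (4 * κ))) := by
  set m : ℝ := ∫ y, F y ∂μ with hm
  rcases hr.eq_or_lt with h0 | hr'
  · rw [← h0]
    simp only [ne_eq, OfNat.ofNat_ne_zero, not_false_eq_true, zero_pow, zero_div, neg_zero, Real.exp_zero]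
    exact measureReal_le_one
  set l : ℝ := r / (2 * κ) with hl
  have hl0 : 0 < l := div_pos hr' (by linarith)
  have hint := integrable_exp_mul_of_abs_le μ hFm hFb l
  have hMGF := integral_exp_mul_le_of_entropy_le μ hFm hFb hEnt hl0.le
  -- Markov on `e^{lF}`
  have hMarkov := mul_meas_ge_le_integral_of_nonneg (ae_of_all _ fun x => (Real.exp_pos (l * F x)).le) hint
    (Real.exp (l * (m + r)))
  have hset : {x | Real.exp (l * (m + r)) ≤ Real.exp (l * F x)} = {x | m + r ≤ F x} := by
    ext x
    simp only [mem_setOf_eq, Real.exp_le_exp]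
    exact ⟨fun h => le_of_mul_le_mul_left h hl0, fun h => mul_le_mul_of_nonneg_left h hl0.le⟩
  rw [hset] at hMarkov
  have hpos : 0 < Real.exp (l * (m + r)) := Real.exp_pos _
  have h1 : μ.real {x | m + r ≤ F x} ≤ Real.exp (-(l * (m + r))) * ∫ x, Real.exp (l * F x) ∂μ := by
    rw [Real.exp_neg, ← div_eq_inv_mul, le_div_iff₀ hpos, mul_comm]
    exact hMarkov
  calc μ.real {x | m + r ≤ F x} ≤ Real.exp (-(l * (m + r))) * ∫ x, Real.exp (l * F x) ∂μ := h1
    _ ≤ Real.exp (-(l * (m + r))) * Real.exp (l * m + κ * l ^ 2) :=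
        mul_le_mul_of_nonneg_left hMGF (Real.exp_pos _).le
    _ = Real.exp (-(r ^ 2 / (4 * κ))) := by
        rw [← Real.exp_add]
        congr 1
        rw [hl]
        field_simp
        ring

end Summit.QuantumFields.YangMills.Theorems.ColdStartUniversality
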